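import Literature.MathematicalPhysics.QuantumFieldTheory.Balaban1983to89.B6BlockDecayGDivBridgeV1

/-!
# `Balaban1983to89.B6BlockDecayGLapBridgeV1` — T. Bałaban, *Propagators and renormalization transformations for lattice gauge theories. II*,
# Commun. Math. Phys. **96** (1984) 223–250 [Balaban1984PropagatorsII], PROPOSITION 2.5 p. 246 / [4] = *Propagators … I*, CMP **95** (1984) 17–40
# [Balaban1984PropagatorsI], PROPOSITION 1.2 (1.110), ITS FOURTH MEMBER `|(ΔGJ)(x)|`, FOR THE ONE-LEVEL PROPAGATOR `G^{(w′)} = G_j` READ ON THE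
# TWO-SCALE CARRIERS: the uniform block bound of `Δ∘G^{(w′)}`, `Δ = Σ_ν∇_ν*∇_ν` the fine vector Laplacian, at the scaling `c = L^j` — the carrier
# transport of B5's theorem (member `m = 3` of the tree's Prop. 1.2 on B5's torus family), all tori, all scales

statement-level skeleton of published theorems with citation tags; proofs where landed; nothing here is a claim about the Yang–Mills mass gap

PDF held: `paper:balaban1984-cmp96-propagators-rt-ii` (journal page = PDF page + 222): p. 246 [PDF 24]; `paper:balaban1984-cmp95-propagators-rt-i` ([4];
journal page = PDF page + 16): Prop. 1.2 p. 35 [PDF 19].  PRINT (verbatim).  [B6] p. 246: *"These operators were thoroughly investigated in paper [4],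
and their properties described in Proposition 1.2. … From these representations we obtain all the necessary properties of the operators H_j, G̃_j. They
follow from the Proposition 1.2 …"*.  [4] Prop. 1.2 p. 35: *"|(GJ)(x)|, |(∇GJ)(x)|, |(G∇*J)(x)|, |(ΔGJ)(x)| ≤ O(1)e^{−δ₀|y−y′|}|J| (1.110) for x ∈ Δ̃(y),
supp J ⊂ Δ̃(y′), with the constant O(1) depending on d only"*.

CITATION HEADER (lean-in-tree rule) — WHAT IS REPRODUCED.  Phase-2 file of the `lit-balaban` typed skeleton (HOME `run/shared/lean/pub/lit-balaban/`),
seat **p22 gen 15**, lane B6 §C (fold owner r03, referee ref-4); SKELETON rows **B6.Prop2.5** / **B6.Eq2.129-2.131** (cells only).  The companion of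
file 12 (`…B6BlockDecayGDivBridgeV1`, the member `G∇*J`) for the LAST member `ΔGJ` of (1.110), for the one-level `G^{(w′)}` (r03's `GE` of the whole
torus of order `j`, weight `w′ = a·n^{d+1}`, `c = L^j`) which enters the two-scale `G` of (2.90) through (2.129)–(2.131) (`G̃_j = (I − H_jQ_j)G^{(w′)}`,
`H_j = G^{(w′)}Q_j*(Q_jG^{(w′)}Q_j*)⁻¹`): the FIRST INPUT of the `ΔGJ` member of Prop. 2.5 for the genuine two-scale `G` (the others — `ΔH_j`, the
assembly — are recorded in the unit's GEN16 plan; this file does not touch them).  §1 the fine vector Laplacian `Δ = Σ_ν ∇_ν*∇_ν` of `T^{(0)}`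
(`∇_ν = n(S_ν − I)`, `∇_ν* = n(S_ν⁻¹ − I)`, file 12's `adjoint_Dop`) pointwise (`DadjD_apply`: `(∇_ν*∇_νx)(b) = n²(2x(b) − x(b − e_ν) − x(b + e_ν))`)
and its dictionary with r02's typed `Lap = Σ_ν ∇_νᴴ∇_ν` on B5's carrier (`re_Lap_TV`, through r03's transport `TV` and b04's `LapOne_mulVec`).
§2 B5's theorem BY NAME at the scales `k ≥ 1`: `eL_three_posScales` — ONE `δ > 0`, ONE `O(1)` for all tori of dimension `d` and block size `L` and
all `1 ≤ k ≤ m + K` (`…B5Prop12GHolds.prop12_famG_printed`, member `m = 3`, p19's `famG_reindex`).  §3 the transport at scales `j ≥ 1`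
(`abs_LapGE_apply_le`: r03's `TV_GE` — `(G^{(w′)}x)~ = Δ_a⁻¹x̃` — and §1).  §4 scale `0` and, more generally, the CRUDE bound at every scale:
`Σ_ν∇_ν*∇_ν∘F` has the block bound `((d+1)n²(2 + 2e^{δ})C, δ)` whenever `F` has `(C, δ)` (`blockBound_Lap_comp_crude`; rows shifted by one fine
step change the block by at most one unit step, file 4's `torusDist_blk_unshift_le_one`) — used at `n = L⁰ = 1` only, with file 6's
`blockBound_GE_scaling`.  §5 **`blockBound_LapGE_scaling`**: `∃ δ > 0, C ≥ 0` (depending on `d, L, a` only) with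
`Σ_{b₀′ : y(b₀′₋) = y}|(ΔG^{(w′)})(e_{b₀′})_{b₀}| ≤ C·e^{−δ|y(b₀₋) − y|_T}` for every volume, every `j ≤ m + K`, all `b₀`, `y`.
IMPORTS BY NAME, restating nothing.  THEOREMS ONLY (no `def`, no `def … : Prop`); standard axioms.
HONEST SCOPE: (i) the ONE-LEVEL `G^{(w′)} = G_j` only (B5's theorem transported) — NOT the two-scale `G` of (2.90), whose `ΔGJ` member needs in
addition `ΔH_j` (the unit's GEN16 plan); (ii) `Δ` is the componentwise `Σ_ν∇_ν*∇_ν` (= `∂*∂ + ∂∂*` on the lattice, [4] (1.21)); (iii) finite tori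
`⟨d + 1, L, m, K, _, _⟩`, `1 ≤ d + 1`, `L` odd `> 1`, `c = L^j`, weight `a·n^{d+1}`, `a > 0`; constants ours and crude, NOT summit progress.
Unit `lit-balaban-p22` (gen 15), 2026-08-22.
-/

noncomputable section

open scoped InnerProductSpace BigOperators Matrix
open Finset

namespace Literature.MathematicalPhysics.QuantumFieldTheory.Balaban1983to89.B6BlockDecayGLapBridgeV1

open LatticeFieldCalculus B5SectBStatements B5Eq117TorusCarriers B6SectADomainsV1 B6SectAOperatorsV1 B6SectAVectorModelV1 B6SectCOperators
  B6SectCTwoScaleV1 B6SectCTwoScaleV1Lattice B5Eq118OneStroke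
open BalabanImbrieJaffe1984to88.BIJ85AxialPropagator411 (BondSpace)
open B4TorusKernel.MultiPeriod (torusSupNorm)
open B4Sect5Torus (IsPseudoDist)
open B5Prop11Plancherel (Tor fine unitVec)
open B5Prop11Lower (Lap)
open B5Prop11SettingModel (Loc189)
open B5DeltaA169 (DeltaA)
open B5Prop12FieldsLattice (distSite cubeT cubeB suppInL supNormL eL)
open B5SettingP12Real (LocR latticeSettingP12R)
open B5Prop12GLattice (famG)
open B5G183FreeRowSum (LapOne_mulVec)
open B6LowerBound2153Torus (rep)
open B6HjGtOpNormV1 (qpE_whole_eq_zero_iff inner_QE_aE_whole)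
open B6GOneLevelV1Bridge (TV TV_apply TV_apply_EK TV_GE)
open B6BlockDecayCalculus (blockBound_of_cubeSup torusDist_isPseudoDist)
open B6BlockDecayHprimeCovV1 (supDist_cast_eq_torusSupNorm eq_of_torusDist_le_zero torusDist_blk_unshift_le_one)
open B6BlockDecayGtV1 (blockBound_GE_scaling)
open B6BlockDecayGDivBridgeV1 (Dadj_apply)
open B10StarCount (shift_unshift unshift_shift)
open B6HprimeOpNormV1 (EK_unshift)
open BalabanImbrieJaffe1984to88.BIJ85Thm711TorusTransport (EK_shift)
open BalabanImbrieJaffe1984to88.BIJ85Prop12BridgeGeometry (supDist_cast_eq_distSite EK_mem_cubeT_blk)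
open BalabanImbrieJaffe1984to88.BIJ85Prop12AllTori (famG_reindex)
open LatticeNorms (supNorm norm_le_supNorm supNorm_le supNorm_nonneg)

/-! ## §1  The fine vector Laplacian `Δ = Σ_ν ∇_ν*∇_ν` of `T^{(0)}`, pointwise, and its dictionary with r02's typed `Lap` -/

section Laplacian

variable {P : Params}

/-- `(∇_νx)(b) = n(x(b + e_ν) − x(b))`. [cite: Balaban1984PropagatorsI, (1.4) p.18] -/
theorem D_apply (s : ℝ) (ν : Fin P.d) (x : BondSpace P) (b₀ : PBond P 0) :
    ((s • (onE (LinearMap.funLeft ℝ ℝ (fun b : PBond P 0 => (⟨b.src.shift ν, b.dir⟩ : PBond P 0))) - LinearMap.id) : BondSpace P →ₗ[ℝ] BondSpace P)) x b₀ =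
      s * (x ⟨b₀.src.shift ν, b₀.dir⟩ - x b₀) := by
  rw [LinearMap.smul_apply, LinearMap.sub_apply, LinearMap.id_apply, PiLp.smul_apply, PiLp.sub_apply, smul_eq_mul]
  rfl

/-- **`(∇_ν*∇_νx)(b) = n²(2x(b) − x(b − e_ν) − x(b + e_ν))`**. [cite: Balaban1984PropagatorsI, (1.21) p.21, (1.110) p.35 («ΔGJ»)] -/
theorem DadjD_apply (s : ℝ) (ν : Fin P.d) (x : BondSpace P) (b₀ : PBond P 0) :
    (((s • (onE (LinearMap.funLeft ℝ ℝ (fun b : PBond P 0 => (⟨b.src.unshift ν, b.dir⟩ : PBond P 0))) - LinearMap.id) : BondSpace P →ₗ[ℝ] BondSpace P)) ∘ₗ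
      ((s • (onE (LinearMap.funLeft ℝ ℝ (fun b : PBond P 0 => (⟨b.src.shift ν, b.dir⟩ : PBond P 0))) - LinearMap.id) : BondSpace P →ₗ[ℝ] BondSpace P))) x b₀ =
      s ^ 2 * (2 * x b₀ - x ⟨b₀.src.unshift ν, b₀.dir⟩ - x ⟨b₀.src.shift ν, b₀.dir⟩) := by
  rw [LinearMap.comp_apply, Dadj_apply, D_apply, D_apply]
  rw [show (⟨(⟨b₀.src.unshift ν, b₀.dir⟩ : PBond P 0).src.shift ν, (⟨b₀.src.unshift ν, b₀.dir⟩ : PBond P 0).dir⟩ : PBond P 0) = b₀ by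
    rw [show (⟨b₀.src.unshift ν, b₀.dir⟩ : PBond P 0).src = b₀.src.unshift ν from rfl, shift_unshift]]
  ring

/-- **`Σ_ν ∇_ν*∇_ν` pointwise**. [cite: Balaban1984PropagatorsI, (1.21) p.21] -/
theorem Lap_apply (s : ℝ) (x : BondSpace P) (b₀ : PBond P 0) :
    (∑ ν : Fin P.d, ((s • (onE (LinearMap.funLeft ℝ ℝ (fun b : PBond P 0 => (⟨b.src.unshift ν, b.dir⟩ : PBond P 0))) - LinearMap.id) : BondSpace P →ₗ[ℝ] BondSpace P)) ∘ₗ ((s • (onE (LinearMap.funLeft ℝ ℝ (fun b : PBond P 0 => (⟨b.src.shift ν, b.dir⟩ : PBond P 0))) - LinearMap.id) : BondSpace P →ₗ[ℝ] BondSpace P))) x b₀ =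
      ∑ ν : Fin P.d, s ^ 2 * (2 * x b₀ - x ⟨b₀.src.unshift ν, b₀.dir⟩ - x ⟨b₀.src.shift ν, b₀.dir⟩) := by
  rw [LinearMap.sum_apply, WithLp.ofLp_sum, Finset.sum_apply]
  exact Finset.sum_congr rfl fun ν _ => DadjD_apply s ν x b₀

end Laplacian

section Dictionary

variable {d L m K : ℕ} [NeZero L] {hd : 1 ≤ d + 1} {hL : Odd L ∧ 1 < L} {j : ℕ}
  (hj' : j ≤ (⟨d + 1, L, m, K, hd, hL⟩ : Params).m + (⟨d + 1, L, m, K, hd, hL⟩ : Params).K)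

/-- **THE DICTIONARY WITH r02's TYPED `Lap = Σ_ν∇_νᴴ∇_ν`** (b04's `LapOne_mulVec`): `Re (Δx̃)(EK b₋, μ(b)) = (Σ_ν∇_ν*∇_νx)(b)` at `n = L^j`.
[cite: Balaban1984PropagatorsI, (1.21) p.21, (1.18) p.20] -/
theorem re_Lap_TV (x : BondSpace (⟨d + 1, L, m, K, hd, hL⟩ : Params)) (b₀ : PBond (⟨d + 1, L, m, K, hd, hL⟩ : Params) 0) :
    ((Lap (L ^ j) (Mk (⟨d + 1, L, m, K, hd, hL⟩ : Params) j) *ᵥ TV hj' x) (EK hj' b₀.src, b₀.dir)).re =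
      ∑ ν : Fin (d + 1), ((L : ℝ) ^ j) ^ 2 * (2 * x b₀ - x ⟨b₀.src.unshift ν, b₀.dir⟩ - x ⟨b₀.src.shift ν, b₀.dir⟩) := by
  have h1 := LapOne_mulVec (L ^ j) (Mk (⟨d + 1, L, m, K, hd, hL⟩ : Params) j) (TV hj' x) (EK hj' b₀.src, b₀.dir)
  rw [Matrix.add_mulVec, Matrix.one_mulVec, Pi.add_apply, add_comm] at h1
  have h2 := add_left_cancel h1
  rw [h2]
  have hEK : ∀ ν : Fin (d + 1),
      TV hj' x (EK hj' b₀.src + unitVec (fine (L ^ j) (Mk (⟨d + 1, L, m, K, hd, hL⟩ : Params) j)) ν, b₀.dir) = ((x ⟨b₀.src.shift ν, b₀.dir⟩ : ℝ) : ℂ) ∧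
      TV hj' x (EK hj' b₀.src - unitVec (fine (L ^ j) (Mk (⟨d + 1, L, m, K, hd, hL⟩ : Params) j)) ν, b₀.dir) = ((x ⟨b₀.src.unshift ν, b₀.dir⟩ : ℝ) : ℂ) := by
    intro ν
    constructor
    · have h := TV_apply_EK hj' x ⟨b₀.src.shift ν, b₀.dir⟩
      rw [show (⟨b₀.src.shift ν, b₀.dir⟩ : PBond (⟨d + 1, L, m, K, hd, hL⟩ : Params) 0).src = b₀.src.shift ν from rfl, EK_shift hj' b₀.src ν] at h
      exact h
    · have h := TV_apply_EK hj' x ⟨b₀.src.unshift ν, b₀.dir⟩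
      rw [show (⟨b₀.src.unshift ν, b₀.dir⟩ : PBond (⟨d + 1, L, m, K, hd, hL⟩ : Params) 0).src = b₀.src.unshift ν from rfl, EK_unshift hj' b₀.src ν] at h
      exact h
  rw [TV_apply_EK, Finset.mul_sum, Complex.re_sum]
  refine Finset.sum_congr rfl fun ν _ => ?_
  rw [(hEK ν).1, (hEK ν).2]
  have e : ((L ^ j : ℕ) : ℂ) ^ 2 * ((((x b₀ : ℝ) : ℂ) - ((x ⟨b₀.src.shift ν, b₀.dir⟩ : ℝ) : ℂ)) + (((x b₀ : ℝ) : ℂ) - ((x ⟨b₀.src.unshift ν, b₀.dir⟩ : ℝ) : ℂ))) =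
      ((((L : ℝ) ^ j) ^ 2 * (2 * x b₀ - x ⟨b₀.src.unshift ν, b₀.dir⟩ - x ⟨b₀.src.shift ν, b₀.dir⟩) : ℝ) : ℂ) := by
    push_cast; ring
  rw [e, Complex.ofReal_re]

end Dictionary


/-! ## §2  [4] Proposition 1.2, the member `|(ΔGJ)(x)|` of (1.110), on B5's carriers: all tori, all scales `k ≥ 1` -/

section PosScales

/-- **[4] PROPOSITION 1.2, THE MEMBER `|(ΔGJ)(x)|` OF (1.110) FOR `G_k = Δ_a⁻¹`, ALL TORI OF DIMENSION `d` AND BLOCK SIZE `L`, ALL SCALES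
`1 ≤ k ≤ m + K`, HYPOTHESIS-FREE**: ONE `δ₀ > 0`, ONE `O(1) ≥ 0` (depending on `d, L, a` only) such that for every torus `P` (`P.d = d`, `P.L = L`),
every such `k`, every real source `J` with `supp J ⊂ Δ̃(y′)`: `sup_{Δ̃(y)}|ΔG_kJ| ≤ O(1)e^{−δ₀|y−y′|}|J|` (on B5's carriers: `eL … 3`, genuine on
vector sources, `0` on the others) — the tree's Prop. 1.2 on B5's torus family of record (`prop12_famG_printed`, member `m = 3`, p19's `famG_reindex`).
[cite: Balaban1984PropagatorsI, Prop. 1.2 (1.110) p.35, p.39–40 («Thus we have finished the proof of Proposition 1.2.»)] -/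
theorem eL_three_posScales (d L : ℕ) {a : ℝ} (ha : 0 < a) :
    ∃ δ : ℝ, 0 < δ ∧ ∃ C : ℝ, 0 ≤ C ∧ ∀ (P : Params) (_ : P.d = d) (_ : P.L = L) (k : ℕ) (_ : 1 ≤ k) (_ : k ≤ P.m + P.K)
      (J : LocR (P.L ^ k) (Mk P k)) (y y' : Tor (Mk P k)), suppInL (P.L ^ k) (Mk P k) J.emb y' →
      eL (P.L ^ k) (Mk P k) a 3 J.emb y ≤ C * Real.exp (-(δ * distSite (Mk P k) y y')) * supNormL (P.L ^ k) (Mk P k) J.emb := by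
  by_cases h : 1 ≤ d ∧ (Odd L ∧ 1 < L)
  · obtain ⟨δ₁, C₁, Cα₁, Cε₁, Cαε₁, hδ₁, hC₁, H₁⟩ := B5Prop12GHolds.prop12_famG_printed (d := d) (L := L) h.1 h.2 ha
    refine ⟨δ₁, hδ₁, C₁, hC₁.le, ?_⟩
    intro P hPd hPL k hk1 hk J y y' hJ
    subst hPd; subst hPL
    have H := H₁ ⟨⟨P.d, P.L, P.m + P.K - k, k, P.hd, P.hL⟩, rfl, rfl, hk1⟩
    rw [famG_reindex] at H
    obtain ⟨He, -, -, -, -⟩ := H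
    exact He 3 J y y' hJ
  · -- no torus has `d = 0` or an inadmissible `L`: the range is empty
    refine ⟨1, one_pos, 0, le_rfl, fun P hPd hPL k hk1 hk J y y' hJ => ?_⟩
    exact (h ⟨hPd ▸ P.hd, hPL ▸ P.hL⟩).elim

end PosScales

/-! ## §3  The transport at the scales `j ≥ 1`: `Δ∘G^{(w′)}` below B5's `sup_{Δ̃(y)}|ΔG_jJ|` -/

section Transport

variable {d L m K : ℕ} [NeZero L] {hd : 1 ≤ d + 1} {hL : Odd L ∧ 1 < L} {j : ℕ}
  (hj' : j ≤ (⟨d + 1, L, m, K, hd, hL⟩ : Params).m + (⟨d + 1, L, m, K, hd, hL⟩ : Params).K)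
  (hc : ((L : ℝ) ^ j) ≠ 0) {a : ℝ} (ha : 0 < a) (hw' : (0 : ℝ) < a * ((L : ℝ) ^ j) ^ (d + 1))

include ha in
/-- **THE POINTWISE TRANSPORT**: if `sup_{Δ̃(y)}|ΔG_jJ| ≤ C e^{−δ|y−y′|}|J|` on B5's carrier of scale `j` (vector sources supported in `Δ̃(y′)`), then for
a fine bond field `x` of `T^{(0)}` supported over the block `B^j(y′)` with `|x| ≤ X` and every fine bond `b₀` over `B^j(y)`:
`|(ΔG^{(w′)}x)(b₀)| ≤ C e^{−δ|y − y′|_T}·X` — r03's `TV_GE` (`(G^{(w′)}x)~ = Δ_a⁻¹x̃`), §1's dictionary `re_Lap_TV`, the block inside the cube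
(`EK_mem_cubeT_blk`). [cite: Balaban1984PropagatorsI, Prop. 1.2 (1.110) p.35; Balaban1984PropagatorsII, p.246] -/
theorem abs_LapGE_apply_le {C δ : ℝ} (hC0 : 0 ≤ C)
    (H : ∀ (T : LocR (((⟨d + 1, L, m, K, hd, hL⟩ : Params).L) ^ j) (Mk (⟨d + 1, L, m, K, hd, hL⟩ : Params) j))
      (y y' : Tor (Mk (⟨d + 1, L, m, K, hd, hL⟩ : Params) j)),
      suppInL (((⟨d + 1, L, m, K, hd, hL⟩ : Params).L) ^ j) (Mk (⟨d + 1, L, m, K, hd, hL⟩ : Params) j) T.emb y' →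
      eL (((⟨d + 1, L, m, K, hd, hL⟩ : Params).L) ^ j) (Mk (⟨d + 1, L, m, K, hd, hL⟩ : Params) j) a 3 T.emb y ≤
        C * Real.exp (-(δ * distSite (Mk (⟨d + 1, L, m, K, hd, hL⟩ : Params) j) y y')) *
          supNormL (((⟨d + 1, L, m, K, hd, hL⟩ : Params).L) ^ j) (Mk (⟨d + 1, L, m, K, hd, hL⟩ : Params) j) T.emb)
    (x : BondSpace (⟨d + 1, L, m, K, hd, hL⟩ : Params)) {X : ℝ} (hX : 0 ≤ X)
    (y y' : Site (⟨d + 1, L, m, K, hd, hL⟩ : Params) j)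
    (hsupp : ∀ b : PBond (⟨d + 1, L, m, K, hd, hL⟩ : Params) 0, x b ≠ 0 → iterBlockOf j b.src = y')
    (hx : ∀ b : PBond (⟨d + 1, L, m, K, hd, hL⟩ : Params) 0, |x b| ≤ X)
    (b₀ : PBond (⟨d + 1, L, m, K, hd, hL⟩ : Params) 0) (hb₀ : iterBlockOf j b₀.src = y) :
    |((∑ ν : Fin (d + 1), ((((L : ℝ) ^ j) • (onE (LinearMap.funLeft ℝ ℝ (fun b : PBond (⟨d + 1, L, m, K, hd, hL⟩ : Params) 0 => (⟨b.src.unshift ν, b.dir⟩ : PBond (⟨d + 1, L, m, K, hd, hL⟩ : Params) 0))) - LinearMap.id) : BondSpace (⟨d + 1, L, m, K, hd, hL⟩ : Params) →ₗ[ℝ] BondSpace (⟨d + 1, L, m, K, hd, hL⟩ : Params))) ∘ₗ ((((L : ℝ) ^ j) • (onE (LinearMap.funLeft ℝ ℝ (fun b : PBond (⟨d + 1, L, m, K, hd, hL⟩ : Params) 0 => (⟨b.src.shift ν, b.dir⟩ : PBond (⟨d + 1, L, m, K, hd, hL⟩ : Params) 0))) - LinearMap.id) : BondSpace (⟨d +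 1, L, m, K, hd, hL⟩ : Params) →ₗ[ℝ] BondSpace (⟨d + 1, L, m, K, hd, hL⟩ : Params)))) ∘ₗ
      GE (Domains.whole (P := (⟨d + 1, L, m, K, hd, hL⟩ : Params)) j hj') hc (w := fun _ => a * ((L : ℝ) ^ j) ^ (d + 1)) (fun _ => hw')) x b₀| ≤
      C * Real.exp (-(δ * torusSupNorm (Mk (⟨d + 1, L, m, K, hd, hL⟩ : Params) j)
        (rep (Mk (⟨d + 1, L, m, K, hd, hL⟩ : Params) j) y - rep (Mk (⟨d + 1, L, m, K, hd, hL⟩ : Params) j) y'))) * X := by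
  classical
  -- the real vector source `x` read on the product torus
  obtain ⟨T, hT⟩ : ∃ T : LocR (L ^ j) (Mk (⟨d + 1, L, m, K, hd, hL⟩ : Params) j), T = LocR.vec (fun b => x ⟨(EK hj').symm b.1, b.2⟩) := ⟨_, rfl⟩
  have hTemb : T.emb = Loc189.vec (fun b => ((x ⟨(EK hj').symm b.1, b.2⟩ : ℝ) : ℂ)) := by
    rw [hT]; rfl
  have hTV : TV hj' x = fun b => ((x ⟨(EK hj').symm b.1, b.2⟩ : ℝ) : ℂ) := by
    funext b
    obtain ⟨z, μ⟩ := b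
    exact TV_apply hj' x z μ
  -- the value through the dictionaries
  have hval : ((∑ ν : Fin (d + 1), ((((L : ℝ) ^ j) • (onE (LinearMap.funLeft ℝ ℝ (fun b : PBond (⟨d + 1, L, m, K, hd, hL⟩ : Params) 0 => (⟨b.src.unshift ν, b.dir⟩ : PBond (⟨d + 1, L, m, K, hd, hL⟩ : Params) 0))) - LinearMap.id) : BondSpace (⟨d + 1, L, m, K, hd, hL⟩ : Params) →ₗ[ℝ] BondSpace (⟨d + 1, L, m, K, hd, hL⟩ : Params))) ∘ₗ ((((L : ℝ) ^ j) • (onE (LinearMap.funLeft ℝ ℝ (fun b : PBond (⟨d + 1, L, m, K, hd, hL⟩ : Params) 0 => (⟨b.src.shift ν, b.dir⟩ : PBond (⟨d + 1, L, m, K, hd, hL⟩ : Params) 0))) - LinearMap.id) : BondSpace (⟨d + 1, L, m, K, hd, hL⟩ : Params) →ₗ[ℝ] BondSpace (⟨d + 1, L, m, K, hd, hL⟩ : Params)))) ∘ₗ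
      GE (Domains.whole (P := (⟨d + 1, L, m, K, hd, hL⟩ : Params)) j hj') hc (w := fun _ => a * ((L : ℝ) ^ j) ^ (d + 1)) (fun _ => hw')) x b₀ =
      ((Lap (L ^ j) (Mk (⟨d + 1, L, m, K, hd, hL⟩ : Params) j) *ᵥ ((DeltaA (L ^ j) (Mk (⟨d + 1, L, m, K, hd, hL⟩ : Params) j) a)⁻¹ *ᵥ
        fun b => ((x ⟨(EK hj').symm b.1, b.2⟩ : ℝ) : ℂ))) (EK hj' b₀.src, b₀.dir)).re := by
    rw [LinearMap.comp_apply, Lap_apply (P := (⟨d + 1, L, m, K, hd, hL⟩ : Params)), ← hTV,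
      ← TV_GE hj' (Domains.whole (P := (⟨d + 1, L, m, K, hd, hL⟩ : Params)) j hj') (qpE_whole_eq_zero_iff hj') (fun _ => hw') ha (inner_QE_aE_whole hj' a) x,
      re_Lap_TV hj']
  -- the support of `T` and its sup norm
  have hsuppT : suppInL (L ^ j) (Mk (⟨d + 1, L, m, K, hd, hL⟩ : Params) j) T.emb y' := by
    rw [hTemb]
    intro b hb
    have hxb : x ⟨(EK hj').symm b.1, b.2⟩ ≠ 0 := by
      intro h0
      exact hb (by show (((x ⟨(EK hj').symm b.1, b.2⟩ : ℝ) : ℂ)) = 0; rw [h0, Complex.ofReal_zero])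
    have hblk : iterBlockOf j ((EK hj').symm b.1) = y' := hsupp _ hxb
    have hmem := EK_mem_cubeT_blk hj' ((EK hj').symm b.1)
    rw [Equiv.apply_symm_apply, hblk] at hmem
    exact hmem
  have hsupT : supNormL (L ^ j) (Mk (⟨d + 1, L, m, K, hd, hL⟩ : Params) j) T.emb ≤ X := by
    rw [hTemb]
    show supNorm Finset.univ (fun b : Tor (fine (L ^ j) (Mk (⟨d + 1, L, m, K, hd, hL⟩ : Params) j)) × Fin (d + 1) =>
      ((x ⟨(EK hj').symm b.1, b.2⟩ : ℝ) : ℂ)) ≤ X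
    refine supNorm_le hX fun b _ => ?_
    rw [Complex.norm_real, Real.norm_eq_abs]
    exact hx _
  -- the value below the cube sup of (1.110), m = 3
  have hmem : (EK hj' b₀.src, b₀.dir) ∈ cubeB (L ^ j) (Mk (⟨d + 1, L, m, K, hd, hL⟩ : Params) j) (iterBlockOf j b₀.src) :=
    Finset.mem_product.mpr ⟨EK_mem_cubeT_blk hj' b₀.src, Finset.mem_univ _⟩
  have h2 : ‖(Lap (L ^ j) (Mk (⟨d + 1, L, m, K, hd, hL⟩ : Params) j) *ᵥ ((DeltaA (L ^ j) (Mk (⟨d + 1, L, m, K, hd, hL⟩ : Params) j) a)⁻¹ *ᵥ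
        fun b => ((x ⟨(EK hj').symm b.1, b.2⟩ : ℝ) : ℂ))) (EK hj' b₀.src, b₀.dir)‖ ≤
      eL (L ^ j) (Mk (⟨d + 1, L, m, K, hd, hL⟩ : Params) j) a 3 T.emb (iterBlockOf j b₀.src) := by
    rw [hTemb, B5Prop12FieldsLattice.eL_three_vec]
    exact norm_le_supNorm (f := Lap (L ^ j) (Mk (⟨d + 1, L, m, K, hd, hL⟩ : Params) j) *ᵥ ((DeltaA (L ^ j) (Mk (⟨d + 1, L, m, K, hd, hL⟩ : Params) j) a)⁻¹ *ᵥ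
        fun b => ((x ⟨(EK hj').symm b.1, b.2⟩ : ℝ) : ℂ))) hmem
  have h3 := H T (iterBlockOf j b₀.src) y' hsuppT
  rw [hb₀] at h2 h3
  have hdist : distSite (Mk (⟨d + 1, L, m, K, hd, hL⟩ : Params) j) y y' =
      torusSupNorm (Mk (⟨d + 1, L, m, K, hd, hL⟩ : Params) j) (rep (Mk (⟨d + 1, L, m, K, hd, hL⟩ : Params) j) y - rep (Mk (⟨d + 1, L, m, K, hd, hL⟩ : Params) j) y') := by
    rw [← supDist_cast_eq_distSite, supDist_cast_eq_torusSupNorm]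
  have hC : 0 ≤ C * Real.exp (-(δ * distSite (Mk (⟨d + 1, L, m, K, hd, hL⟩ : Params) j) y y')) := mul_nonneg hC0 (Real.exp_pos _).le
  rw [hval, ← hdist]
  calc |((Lap (L ^ j) (Mk (⟨d + 1, L, m, K, hd, hL⟩ : Params) j) *ᵥ ((DeltaA (L ^ j) (Mk (⟨d + 1, L, m, K, hd, hL⟩ : Params) j) a)⁻¹ *ᵥ
        fun b => ((x ⟨(EK hj').symm b.1, b.2⟩ : ℝ) : ℂ))) (EK hj' b₀.src, b₀.dir)).re|
      ≤ eL (L ^ j) (Mk (⟨d + 1, L, m, K, hd, hL⟩ : Params) j) a 3 T.emb y := (Complex.abs_re_le_norm _).trans h2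
    _ ≤ C * Real.exp (-(δ * distSite (Mk (⟨d + 1, L, m, K, hd, hL⟩ : Params) j) y y')) * supNormL (L ^ j) (Mk (⟨d + 1, L, m, K, hd, hL⟩ : Params) j) T.emb := h3
    _ ≤ C * Real.exp (-(δ * distSite (Mk (⟨d + 1, L, m, K, hd, hL⟩ : Params) j) y y')) * X := mul_le_mul_of_nonneg_left hsupT hC

end Transport

/-! ## §4  The crude bound at every scale (used at `n = L⁰ = 1`): `Σ_ν∇_ν*∇_ν∘F` from the block bound of `F` -/

section Crude

variable {d L m K : ℕ} [NeZero L] {hd : 1 ≤ d + 1} {hL : Odd L ∧ 1 < L} {j : ℕ}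
  (hj' : j ≤ (⟨d + 1, L, m, K, hd, hL⟩ : Params).m + (⟨d + 1, L, m, K, hd, hL⟩ : Params).K)

omit [NeZero L] in
include hj' in
/-- **ROWS ONE FINE STEP APART**: a block bound `(C, δ)` of `F` at the row `b₀ ∓ e_ν` is a block bound `(Ce^{δ}, δ)` at the row `b₀` (the blocks of
`b₀₋` and `b₀₋ ∓ e_ν` are at unit distance `≤ 1`, file 4's `torusDist_blk_unshift_le_one`). [cite: Balaban1984PropagatorsI, (1.18) p.20, (1.110) p.35] -/
theorem exp_row_step_le {C δ : ℝ} (hC : 0 ≤ C) (hδ : 0 ≤ δ) (x : Site (⟨d + 1, L, m, K, hd, hL⟩ : Params) 0) (ν : Fin (d + 1))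
    (y : Site (⟨d + 1, L, m, K, hd, hL⟩ : Params) j) :
    C * Real.exp (-(δ * torusSupNorm (Mk (⟨d + 1, L, m, K, hd, hL⟩ : Params) j)
        (rep (Mk (⟨d + 1, L, m, K, hd, hL⟩ : Params) j) (iterBlockOf j (x.unshift ν)) - rep (Mk (⟨d + 1, L, m, K, hd, hL⟩ : Params) j) y))) ≤
      C * Real.exp δ * Real.exp (-(δ * torusSupNorm (Mk (⟨d + 1, L, m, K, hd, hL⟩ : Params) j)
        (rep (Mk (⟨d + 1, L, m, K, hd, hL⟩ : Params) j) (iterBlockOf j x) - rep (Mk (⟨d + 1, L, m, K, hd, hL⟩ : Params) j) y))) ∧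
    C * Real.exp (-(δ * torusSupNorm (Mk (⟨d + 1, L, m, K, hd, hL⟩ : Params) j)
        (rep (Mk (⟨d + 1, L, m, K, hd, hL⟩ : Params) j) (iterBlockOf j (x.shift ν)) - rep (Mk (⟨d + 1, L, m, K, hd, hL⟩ : Params) j) y))) ≤
      C * Real.exp δ * Real.exp (-(δ * torusSupNorm (Mk (⟨d + 1, L, m, K, hd, hL⟩ : Params) j)
        (rep (Mk (⟨d + 1, L, m, K, hd, hL⟩ : Params) j) (iterBlockOf j x) - rep (Mk (⟨d + 1, L, m, K, hd, hL⟩ : Params) j) y))) := by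
  have hρ : IsPseudoDist (fun t t' : Site (⟨d + 1, L, m, K, hd, hL⟩ : Params) j => torusSupNorm (Mk (⟨d + 1, L, m, K, hd, hL⟩ : Params) j)
      (rep (Mk (⟨d + 1, L, m, K, hd, hL⟩ : Params) j) t - rep (Mk (⟨d + 1, L, m, K, hd, hL⟩ : Params) j) t')) :=
    torusDist_isPseudoDist (Mk (⟨d + 1, L, m, K, hd, hL⟩ : Params) j)
  -- generic step: a row whose block is within unit distance `1` of the block of `x`
  have key : ∀ x' : Site (⟨d + 1, L, m, K, hd, hL⟩ : Params) 0,
      torusSupNorm (Mk (⟨d + 1, L, m, K, hd, hL⟩ : Params) j) (rep (Mk (⟨d + 1, L, m, K, hd, hL⟩ : Params) j) (iterBlockOf j x) -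
        rep (Mk (⟨d + 1, L, m, K, hd, hL⟩ : Params) j) (iterBlockOf j x')) ≤ 1 →
      C * Real.exp (-(δ * torusSupNorm (Mk (⟨d + 1, L, m, K, hd, hL⟩ : Params) j)
          (rep (Mk (⟨d + 1, L, m, K, hd, hL⟩ : Params) j) (iterBlockOf j x') - rep (Mk (⟨d + 1, L, m, K, hd, hL⟩ : Params) j) y))) ≤
        C * Real.exp δ * Real.exp (-(δ * torusSupNorm (Mk (⟨d + 1, L, m, K, hd, hL⟩ : Params) j)
          (rep (Mk (⟨d + 1, L, m, K, hd, hL⟩ : Params) j) (iterBlockOf j x) - rep (Mk (⟨d + 1, L, m, K, hd, hL⟩ : Params) j) y))) := by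
    intro x' h1
    have ht := hρ.triangle (iterBlockOf j x) (iterBlockOf j x') y
    rw [mul_assoc, ← Real.exp_add]
    refine mul_le_mul_of_nonneg_left (Real.exp_le_exp.mpr ?_) hC
    nlinarith
  constructor
  · refine key (x.unshift ν) ?_
    rw [hρ.symm]
    exact torusDist_blk_unshift_le_one hj' x ν
  · refine key (x.shift ν) ?_
    have h := torusDist_blk_unshift_le_one hj' (x.shift ν) ν
    rw [unshift_shift] at h
    exact h

omit [NeZero L] in
include hj' in
/-- **THE CRUDE BOUND**: if `F` (into the fine bond fields) has the block bound `(C, δ)` at every row, then `Σ_ν∇_ν*∇_ν∘F` (factor `n = s`) has the block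
bound `((d+1)s²(2 + 2e^{δ})C, δ)` — `|(∇_ν*∇_νv)(b)| ≤ s²(2|v(b)| + |v(b − e_ν)| + |v(b + e_ν)|)` and `exp_row_step_le`.  (Useful at `s = n = 1` only:
the genuine member `ΔGJ` of (1.110) has NO factor `n²`.) [cite: Balaban1984PropagatorsI, (1.21) p.21, Prop. 1.2 (1.110) p.35] -/
theorem blockBound_Lap_comp_crude {κ : Type*} [Fintype κ] [DecidableEq κ] (F : EuclideanSpace ℝ κ →ₗ[ℝ] BondSpace (⟨d + 1, L, m, K, hd, hL⟩ : Params))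
    (pκ : κ → Site (⟨d + 1, L, m, K, hd, hL⟩ : Params) j) {C δ : ℝ} (hC : 0 ≤ C) (hδ : 0 ≤ δ) (s : ℝ)
    (hF : ∀ (b₀ : PBond (⟨d + 1, L, m, K, hd, hL⟩ : Params) 0) (y : Site (⟨d + 1, L, m, K, hd, hL⟩ : Params) j),
      ∑ k ∈ univ.filter (fun k => pκ k = y), |F (EuclideanSpace.single k (1 : ℝ)) b₀| ≤
        C * Real.exp (-(δ * torusSupNorm (Mk (⟨d + 1, L, m, K, hd, hL⟩ : Params) j)
          (rep (Mk (⟨d + 1, L, m, K, hd, hL⟩ : Params) j) (iterBlockOf j b₀.src) - rep (Mk (⟨d + 1, L, m, K, hd, hL⟩ : Params) j) y))))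
    (b₀ : PBond (⟨d + 1, L, m, K, hd, hL⟩ : Params) 0) (y : Site (⟨d + 1, L, m, K, hd, hL⟩ : Params) j) :
    ∑ k ∈ univ.filter (fun k => pκ k = y),
        |((∑ ν : Fin (d + 1), ((s • (onE (LinearMap.funLeft ℝ ℝ (fun b : PBond (⟨d + 1, L, m, K, hd, hL⟩ : Params) 0 => (⟨b.src.unshift ν, b.dir⟩ : PBond (⟨d + 1, L, m, K, hd, hL⟩ : Params) 0))) - LinearMap.id) : BondSpace (⟨d + 1, L, m, K, hd, hL⟩ : Params) →ₗ[ℝ] BondSpace (⟨d + 1, L, m, K, hd, hL⟩ : Params))) ∘ₗ ((s • (onE (LinearMap.funLeft ℝ ℝ (fun b : PBond (⟨d + 1, L, m, K, hd, hL⟩ : Params) 0 => (⟨b.src.shift ν, b.dir⟩ : PBond (⟨d + 1, L, m, K, hd, hL⟩ : Params) 0))) - LinearMap.id) : BondSpace (⟨d + 1, L, m, K, hd, hL⟩ : Params) →ₗ[ℝ] BondSpace (⟨d + 1, L, m, K, hd, hL⟩ : Params)))) ∘ₗ F)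
          (EuclideanSpace.single k (1 : ℝ)) b₀| ≤
      ((d + 1 : ℕ) : ℝ) * (s ^ 2 * ((2 + 2 * Real.exp δ) * C)) * Real.exp (-(δ * torusSupNorm (Mk (⟨d + 1, L, m, K, hd, hL⟩ : Params) j)
          (rep (Mk (⟨d + 1, L, m, K, hd, hL⟩ : Params) j) (iterBlockOf j b₀.src) - rep (Mk (⟨d + 1, L, m, K, hd, hL⟩ : Params) j) y))) := by
  -- abbreviations for the three rows
  set E := Real.exp (-(δ * torusSupNorm (Mk (⟨d + 1, L, m, K, hd, hL⟩ : Params) j)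
          (rep (Mk (⟨d + 1, L, m, K, hd, hL⟩ : Params) j) (iterBlockOf j b₀.src) - rep (Mk (⟨d + 1, L, m, K, hd, hL⟩ : Params) j) y))) with hE
  have hs2 : 0 ≤ s ^ 2 := sq_nonneg s
  -- per direction
  have hν : ∀ ν : Fin (d + 1), ∑ k ∈ univ.filter (fun k => pκ k = y),
      |s ^ 2 * (2 * F (EuclideanSpace.single k (1 : ℝ)) b₀ - F (EuclideanSpace.single k (1 : ℝ)) ⟨b₀.src.unshift ν, b₀.dir⟩
        - F (EuclideanSpace.single k (1 : ℝ)) ⟨b₀.src.shift ν, b₀.dir⟩)| ≤ s ^ 2 * ((2 + 2 * Real.exp δ) * C) * E := by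
    intro ν
    have h0 := hF b₀ y
    have h1 := (hF ⟨b₀.src.unshift ν, b₀.dir⟩ y).trans (exp_row_step_le hj' hC hδ b₀.src ν y).1
    have h2 := (hF ⟨b₀.src.shift ν, b₀.dir⟩ y).trans (exp_row_step_le hj' hC hδ b₀.src ν y).2
    rw [← hE] at h0 h1 h2
    calc ∑ k ∈ univ.filter (fun k => pκ k = y),
          |s ^ 2 * (2 * F (EuclideanSpace.single k (1 : ℝ)) b₀ - F (EuclideanSpace.single k (1 : ℝ)) ⟨b₀.src.unshift ν, b₀.dir⟩
            - F (EuclideanSpace.single k (1 : ℝ)) ⟨b₀.src.shift ν, b₀.dir⟩)|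
        ≤ ∑ k ∈ univ.filter (fun k => pκ k = y), s ^ 2 * (2 * |F (EuclideanSpace.single k (1 : ℝ)) b₀| + |F (EuclideanSpace.single k (1 : ℝ)) ⟨b₀.src.unshift ν, b₀.dir⟩|
            + |F (EuclideanSpace.single k (1 : ℝ)) ⟨b₀.src.shift ν, b₀.dir⟩|) := by
          refine Finset.sum_le_sum fun k _ => ?_
          rw [abs_mul, abs_of_nonneg hs2]
          refine mul_le_mul_of_nonneg_left ?_ hs2
          have := abs_sub (2 * F (EuclideanSpace.single k (1 : ℝ)) b₀ - F (EuclideanSpace.single k (1 : ℝ)) ⟨b₀.src.unshift ν, b₀.dir⟩)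
            (F (EuclideanSpace.single k (1 : ℝ)) ⟨b₀.src.shift ν, b₀.dir⟩)
          have := abs_sub (2 * F (EuclideanSpace.single k (1 : ℝ)) b₀) (F (EuclideanSpace.single k (1 : ℝ)) ⟨b₀.src.unshift ν, b₀.dir⟩)
          rw [abs_mul, abs_two] at this
          linarith
      _ = s ^ 2 * (2 * ∑ k ∈ univ.filter (fun k => pκ k = y), |F (EuclideanSpace.single k (1 : ℝ)) b₀|
            + ∑ k ∈ univ.filter (fun k => pκ k = y), |F (EuclideanSpace.single k (1 : ℝ)) ⟨b₀.src.unshift ν, b₀.dir⟩|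
            + ∑ k ∈ univ.filter (fun k => pκ k = y), |F (EuclideanSpace.single k (1 : ℝ)) ⟨b₀.src.shift ν, b₀.dir⟩|) := by
          rw [← Finset.mul_sum, Finset.sum_add_distrib, Finset.sum_add_distrib, Finset.mul_sum]
      _ ≤ s ^ 2 * (2 * (C * E) + C * Real.exp δ * E + C * Real.exp δ * E) := by
          refine mul_le_mul_of_nonneg_left ?_ hs2
          linarith
      _ = s ^ 2 * ((2 + 2 * Real.exp δ) * C) * E := by ring
  -- sum over the directions
  calc ∑ k ∈ univ.filter (fun k => pκ k = y),
        |((∑ ν : Fin (d + 1), ((s • (onE (LinearMap.funLeft ℝ ℝ (fun b : PBond (⟨d + 1, L, m, K, hd, hL⟩ : Params) 0 => (⟨b.src.unshift ν, b.dir⟩ : PBond (⟨d + 1, L, m, K, hd, hL⟩ : Params) 0))) - LinearMap.id) : BondSpace (⟨d + 1, L, m, K, hd, hL⟩ : Params) →ₗ[ℝ] BondSpace (⟨d + 1, L, m, K, hd, hL⟩ : Params))) ∘ₗ ((s • (onE (LinearMap.funLeft ℝ ℝ (fun b : PBond (⟨d + 1, L, m, K, hd, hL⟩ : Params) 0 =>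 (⟨b.src.shift ν, b.dir⟩ : PBond (⟨d + 1, L, m, K, hd, hL⟩ : Params) 0))) - LinearMap.id) : BondSpace (⟨d + 1, L, m, K, hd, hL⟩ : Params) →ₗ[ℝ] BondSpace (⟨d + 1, L, m, K, hd, hL⟩ : Params)))) ∘ₗ F)
          (EuclideanSpace.single k (1 : ℝ)) b₀|
      = ∑ k ∈ univ.filter (fun k => pκ k = y), |∑ ν : Fin (d + 1), s ^ 2 * (2 * F (EuclideanSpace.single k (1 : ℝ)) b₀
          - F (EuclideanSpace.single k (1 : ℝ)) ⟨b₀.src.unshift ν, b₀.dir⟩ - F (EuclideanSpace.single k (1 : ℝ)) ⟨b₀.src.shift ν, b₀.dir⟩)| := by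
        refine Finset.sum_congr rfl fun k _ => ?_
        rw [LinearMap.comp_apply, Lap_apply (P := (⟨d + 1, L, m, K, hd, hL⟩ : Params))]
    _ ≤ ∑ k ∈ univ.filter (fun k => pκ k = y), ∑ ν : Fin (d + 1), |s ^ 2 * (2 * F (EuclideanSpace.single k (1 : ℝ)) b₀
          - F (EuclideanSpace.single k (1 : ℝ)) ⟨b₀.src.unshift ν, b₀.dir⟩ - F (EuclideanSpace.single k (1 : ℝ)) ⟨b₀.src.shift ν, b₀.dir⟩)| :=
        Finset.sum_le_sum fun k _ => Finset.abs_sum_le_sum_abs _ _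
    _ = ∑ ν : Fin (d + 1), ∑ k ∈ univ.filter (fun k => pκ k = y), |s ^ 2 * (2 * F (EuclideanSpace.single k (1 : ℝ)) b₀
          - F (EuclideanSpace.single k (1 : ℝ)) ⟨b₀.src.unshift ν, b₀.dir⟩ - F (EuclideanSpace.single k (1 : ℝ)) ⟨b₀.src.shift ν, b₀.dir⟩)| :=
        Finset.sum_comm
    _ ≤ ∑ _ν : Fin (d + 1), s ^ 2 * ((2 + 2 * Real.exp δ) * C) * E := Finset.sum_le_sum fun ν _ => hν ν
    _ = ((d + 1 : ℕ) : ℝ) * (s ^ 2 * ((2 + 2 * Real.exp δ) * C)) * E := by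
        rw [Finset.sum_const, Finset.card_univ, Fintype.card_fin, nsmul_eq_mul]; ring

end Crude

/-! ## §5  `Δ∘G^{(w′)}` has the uniform block bound `(O(1), δ₀)` at the scaling, all scales -/

open Classical in
/-- **[4] PROPOSITION 1.2, THE MEMBER `ΔGJ` OF (1.110), FOR `G^{(w′)}` AS A BLOCK BOUND** (`c = L^j`, `w′ = a·n^{d+1}`, `Δ = Σ_ν∇_ν*∇_ν`): there are
`δ > 0`, `C ≥ 0` depending on `d, L, a` only such that for every volume `(m, K)`, every `j ≤ m + K`, all fine bonds `b₀` and unit sites `y`,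
`Σ_{b₀′ : y(b₀′₋) = y}|(ΔG^{(w′)})(e_{b₀′})_{b₀}| ≤ C·e^{−δ|y(b₀₋) − y|_T}` — scales `j ≥ 1`: §2 transported by §3 and turned into a block bound by
file 2's `blockBound_of_cubeSup`; scale `0` (`n = 1`): §4 with file 6's `blockBound_GE_scaling`.
[cite: Balaban1984PropagatorsI, Prop. 1.2 (1.110) p.35; Balaban1984PropagatorsII, p.246 («They follow from the Proposition 1.2»)] -/
theorem blockBound_LapGE_scaling (d L : ℕ) (hd : 1 ≤ d + 1) (hL : Odd L ∧ 1 < L) {a : ℝ} (ha : 0 < a) :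
    ∃ δ : ℝ, 0 < δ ∧ ∃ C : ℝ, 0 ≤ C ∧ ∀ (m K j : ℕ)
      (hj' : j ≤ (⟨d + 1, L, m, K, hd, hL⟩ : Params).m + (⟨d + 1, L, m, K, hd, hL⟩ : Params).K) (hc : ((L : ℝ) ^ j) ≠ 0)
      (hw' : (0 : ℝ) < a * ((L : ℝ) ^ j) ^ (d + 1))
      (b₀ : PBond (⟨d + 1, L, m, K, hd, hL⟩ : Params) 0) (y : Site (⟨d + 1, L, m, K, hd, hL⟩ : Params) j),
      ∑ b₀' ∈ univ.filter (fun b₀' : PBond (⟨d + 1, L, m, K, hd, hL⟩ : Params) 0 => iterBlockOf j b₀'.src = y),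
          |((∑ ν : Fin (d + 1), ((((L : ℝ) ^ j) • (onE (LinearMap.funLeft ℝ ℝ (fun b : PBond (⟨d + 1, L, m, K, hd, hL⟩ : Params) 0 => (⟨b.src.unshift ν, b.dir⟩ : PBond (⟨d + 1, L, m, K, hd, hL⟩ : Params) 0))) - LinearMap.id) : BondSpace (⟨d + 1, L, m, K, hd, hL⟩ : Params) →ₗ[ℝ] BondSpace (⟨d + 1, L, m, K, hd, hL⟩ : Params))) ∘ₗ ((((L : ℝ) ^ j) • (onE (LinearMap.funLeft ℝ ℝ (fun b : PBond (⟨d + 1, L, m, K, hd, hL⟩ : Params) 0 => (⟨b.src.shift ν, b.dir⟩ : PBond (⟨d + 1, L, m, K, hd, hL⟩ : Params) 0))) - LinearMap.id) : BondSpace (⟨d + 1, L, m, K, hd, hL⟩ : Params) →ₗ[ℝ] BondSpace (⟨d + 1, L, m, K, hd, hL⟩ : Params)))) ∘ₗ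
            GE (Domains.whole (P := (⟨d + 1, L, m, K, hd, hL⟩ : Params)) j hj') hc (w := fun _ => a * ((L : ℝ) ^ j) ^ (d + 1)) (fun _ => hw'))
            (EuclideanSpace.single b₀' (1 : ℝ)) b₀| ≤
        C * Real.exp (-(δ * torusSupNorm (Mk (⟨d + 1, L, m, K, hd, hL⟩ : Params) j)
            (rep (Mk (⟨d + 1, L, m, K, hd, hL⟩ : Params) j) (iterBlockOf j b₀.src) - rep (Mk (⟨d + 1, L, m, K, hd, hL⟩ : Params) j) y))) := by
  obtain ⟨δ₃, hδ₃, C₃, hC₃, H₃⟩ := eL_three_posScales (d + 1) L ha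
  obtain ⟨δ₀, hδ₀, C₀, hC₀, H₀⟩ := blockBound_GE_scaling d L hd hL ha
  -- the scale-0 constant
  set C₀' : ℝ := ((d + 1 : ℕ) : ℝ) * ((1 : ℝ) ^ 2 * ((2 + 2 * Real.exp δ₀) * C₀)) with hC₀'
  have hC₀'nn : 0 ≤ C₀' := by rw [hC₀']; positivity
  refine ⟨min δ₃ δ₀, lt_min hδ₃ hδ₀, max C₃ C₀', le_max_of_le_left hC₃, fun m K j hj' hc hw' b₀ y => ?_⟩
  haveI : NeZero L := ⟨by have := hL.2; omega⟩
  have hρ : IsPseudoDist (fun t t' : Site (⟨d + 1, L, m, K, hd, hL⟩ : Params) j => torusSupNorm (Mk (⟨d + 1, L, m, K, hd, hL⟩ : Params) j)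
      (rep (Mk (⟨d + 1, L, m, K, hd, hL⟩ : Params) j) t - rep (Mk (⟨d + 1, L, m, K, hd, hL⟩ : Params) j) t')) :=
    torusDist_isPseudoDist (Mk (⟨d + 1, L, m, K, hd, hL⟩ : Params) j)
  have hD : 0 ≤ torusSupNorm (Mk (⟨d + 1, L, m, K, hd, hL⟩ : Params) j)
      (rep (Mk (⟨d + 1, L, m, K, hd, hL⟩ : Params) j) (iterBlockOf j b₀.src) - rep (Mk (⟨d + 1, L, m, K, hd, hL⟩ : Params) j) y) := hρ.nonneg _ _
  -- weakening of either case to the common constants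
  have weak : ∀ {C' δ' : ℝ}, C' ≤ max C₃ C₀' → min δ₃ δ₀ ≤ δ' →
      C' * Real.exp (-(δ' * torusSupNorm (Mk (⟨d + 1, L, m, K, hd, hL⟩ : Params) j)
        (rep (Mk (⟨d + 1, L, m, K, hd, hL⟩ : Params) j) (iterBlockOf j b₀.src) - rep (Mk (⟨d + 1, L, m, K, hd, hL⟩ : Params) j) y))) ≤
      max C₃ C₀' * Real.exp (-(min δ₃ δ₀ * torusSupNorm (Mk (⟨d + 1, L, m, K, hd, hL⟩ : Params) j)
        (rep (Mk (⟨d + 1, L, m, K, hd, hL⟩ : Params) j) (iterBlockOf j b₀.src) - rep (Mk (⟨d + 1, L, m, K, hd, hL⟩ : Params) j) y))) := by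
    intro C' δ' hC' hδ'
    have h1 : Real.exp (-(δ' * torusSupNorm (Mk (⟨d + 1, L, m, K, hd, hL⟩ : Params) j)
        (rep (Mk (⟨d + 1, L, m, K, hd, hL⟩ : Params) j) (iterBlockOf j b₀.src) - rep (Mk (⟨d + 1, L, m, K, hd, hL⟩ : Params) j) y))) ≤
        Real.exp (-(min δ₃ δ₀ * torusSupNorm (Mk (⟨d + 1, L, m, K, hd, hL⟩ : Params) j)
        (rep (Mk (⟨d + 1, L, m, K, hd, hL⟩ : Params) j) (iterBlockOf j b₀.src) - rep (Mk (⟨d + 1, L, m, K, hd, hL⟩ : Params) j) y))) :=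
      Real.exp_le_exp.mpr (by nlinarith)
    exact (mul_le_mul_of_nonneg_right hC' (Real.exp_pos _).le).trans
      (mul_le_mul_of_nonneg_left h1 ((le_max_of_le_left hC₃)))
  rcases Nat.eq_zero_or_pos j with hj0 | hj1
  · -- scale 0: `n = L⁰ = 1`, the crude bound with file 6's block bound of `G^{(w′)}`
    subst hj0
    have h := blockBound_Lap_comp_crude (j := 0) hj' (GE (Domains.whole (P := (⟨d + 1, L, m, K, hd, hL⟩ : Params)) 0 hj') hc
        (w := fun _ => a * ((L : ℝ) ^ 0) ^ (d + 1)) (fun _ => hw'))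
      (fun b₀' : PBond (⟨d + 1, L, m, K, hd, hL⟩ : Params) 0 => iterBlockOf 0 b₀'.src) hC₀ hδ₀.le ((L : ℝ) ^ 0)
      (fun b y => H₀ m K 0 hj' hc hw' b y) b₀ y
    have hC : ((d + 1 : ℕ) : ℝ) * ((((L : ℝ) ^ 0)) ^ 2 * ((2 + 2 * Real.exp δ₀) * C₀)) ≤ max C₃ C₀' :=
      le_max_of_le_right (le_of_eq (by rw [hC₀', pow_zero]))
    exact h.trans (weak hC (min_le_right _ _))
  · -- scales `j ≥ 1`: B5's member `m = 3` transported
    have h := blockBound_of_cubeSup (ρ := (fun t t' : Site (⟨d + 1, L, m, K, hd, hL⟩ : Params) j => torusSupNorm (Mk (⟨d + 1, L, m, K, hd, hL⟩ : Params) j) (rep (Mk (⟨d + 1, L, m, K, hd, hL⟩ : Params) j) t - rep (Mk (⟨d + 1, L, m, K, hd, hL⟩ : Params) j) t')))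
      hρ _ (fun b₀ : PBond (⟨d + 1, L, m, K, hd, hL⟩ : Params) 0 => iterBlockOf j b₀.src)
      (fun b₀ : PBond (⟨d + 1, L, m, K, hd, hL⟩ : Params) 0 => iterBlockOf j b₀.src) le_rfl (fun x X y y' hX hsupp hx i hi =>
        abs_LapGE_apply_le hj' hc ha hw' hC₃ (H₃ (⟨d + 1, L, m, K, hd, hL⟩ : Params) rfl rfl j hj1 hj') x hX y y'
          (fun b hb => eq_of_torusDist_le_zero (hsupp b hb)) hx i (eq_of_torusDist_le_zero hi)) b₀ y
    exact h.trans (weak (le_max_left _ _) (min_le_left _ _))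

end Literature.MathematicalPhysics.QuantumFieldTheory.Balaban1983to89.B6BlockDecayGLapBridgeV1

end
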